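import Summits.HodgeConjecture.HodgeConjecture.Theorems.WeilTypeLadderQuaternionSymmetry
import Summits.HodgeConjecture.HodgeConjecture.Theorems.WeilTypeLadderOnPath
import Literature.AlgebraicGeometry.HodgeTheory.WeilClassesSixfolds
import Literature.AlgebraicGeometry.Motives.HyperbolicWeilTypeProduct
import Literature.AlgebraicGeometry.VanGeemenVerra2003.QuaternionicHodgeClasses
import HarnessLib

/-!
# WeilTypeLadder · quaternion-type SIXFOLDS: one split quadratic subfield ⇒ Weil classes of EVERY quadratic subfield (⇐ F0a)

b2b cell `hweil` (packet `run/shared/lean/b2b/hodge-weil/`, CENSUS.md `## P3-g35`; prover 3). Companion of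
`Theorems/WeilTypeLadderQuaternionicPrym.lean` (eightfolds), for the FIRST RUNG ABOVE THE FLOOR (R3 = R1′: Weil classes
on abelian sixfolds of NON-split Weil type).

THE OBSERVATION (packet `b2b-hweil-pv3-g35/QUATERNIONIC-PRYMS.md` §4, pen-and-paper with exact machine checks). Let
`(A, E, F)` be a polarized abelian variety of QUATERNION type (van Geemen–Verra 2003, 2.1), `F = (-a,-b)_ℚ` definite,
`dim A = 2n`. Then `(A, K)` is of Weil type `(n, n)` for EVERY quadratic `K = ℚ(φ) ⊂ F` (Lemma 4.5), and van Geemen's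
discriminant is `det H_K ≡ (-N(j_K))ⁿ · δ_F(A, E) mod Nm(K^×)`, `j_K ∈ F` pure with `φ j_K = -j_K φ`, `δ_F` the
reduced norm of the `F`-skew-hermitian Gram matrix of `E` (packet THEOREM DISC). For `n` EVEN the class does not depend
on `K`; for `n` ODD — abelian SIXFOLDS, `n = 3` — IT DOES: e.g. for `F = ℍ_ℚ`, `δ_F = 1`, `(A, ℚ(√-d))` is SPLIT iff
`d` is a sum of two squares, so `(A, ℚ(i))` is split while `(A, ℚ(√-3))`, `(A, ℚ(√-6))`, `(A, ℚ(√-11))`, … are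
NON-split (verified exactly on the ramified quaternionic Prym sixfolds of Donagi–Livné's `(g, a) = (2, 1)` towers,
`code/pv3-g35/qprym_disc.py`). Since `W_{K'} ⊂ W_F = Σ_x x^* W_K` for all `K, K' ⊂ F` (Prop. 4.7, Cor. 4.9), the
algebraicity of the Weil classes of ONE split structure `(A, K)` — which the floor F0a
(`Markman2025_weilClasses_algebraic_hyperbolicSixfold`, Markman 2025 Thm. 1.5.1, UNREFEREED) provides — gives the
algebraicity of the Weil classes of ALL structures `(A, K')`, the NON-SPLIT ones included: **on the 3-dimensional
quaternion-type loci, the first rung above the floor FOLLOWS FROM THE FLOOR.**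

THIS FILE (kernel; theorems only, no definition, no new fact, no `sorry`):
* `weilClassesOf_quaternionSixfold_le_algebraicClasses_of_floor` — for `A` of dimension `6` with anticommuting
  `φ, χ` (`φ² = -a`, `χ² = -b`, `a, b ≥ 1`), a rational hyperplane class `h = e^*l` of quaternion type for the two
  generators (`φ^*h = a h`, `χ^*h = b h`) such that `(A, ℚ(φ))` is HYPERBOLIC for the `K`-symmetrised class `a·h + φ^*h`
  (the floor's hypothesis `Motives.IsHyperbolicWeilType A φ 3 _`), and every non-zero `x = pφ + qχ + rφχ ∈ ℤ⟨φ, χ⟩`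
  (`x² = -m`, `m = p²a + q²b + r²ab`): `weilClassesOf A x 3 m ≤ algebraicClasses A.X 3` — EVERY class of the Weil plane of
  `(A, ℚ(x))`, whatever its discriminant. Conditional BY NAME on F0a (unrefereed) and `VanGeemenVerra2003_quaternionHodgeClasses`
  (refereed); chain `φ → φχ → Y = qb·φ - pa·χ → x` of anticommuting pairs through Prop. 4.7, polarization hypotheses
  discharged by the quaternion-symmetry lemma (`WeilTypeLadderQuaternionSymmetry`).
* `nonsplitSixfolds_quaternionType_of_floor` — the literal body of the rung `WeilTypeLadder.NonsplitSixfolds` (R1′) at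
  `(A, φ, d) := (A, x, m)` on this locus follows from the floor (its "no hyperbolic polarization" binder unused), and
  `nonsplitSixfolds_quaternionType_of_hodgeConjecture` (on-path, trivial).

HONEST LABEL. An EDGE floor ⟶ R1′ on a proper sublocus (quaternion type: dimension `n(n-1)/2 = 3` inside the
9-dimensional non-split sixfold components of the `K'` concerned), CONDITIONAL on Markman's unrefereed Thm. 1.5.1; that
the structures `(A, K')` reached include NON-split ones is a packet-level statement about `det H` (no discriminant on
the carriers), exactly computed for the quaternionic Prym sixfolds; an UNCONDITIONAL refereed version on the
Donagi–Livné `(2,1)` Prym locus (Schoen 1988 Cor. 3.1 at `(q, m, r) = (3, 4, 1)`, simplicity automatic for `r = 1`, in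
place of F0a) is stated in the packet and NOT typed here. Not a rung; 0 unconditional rungs above the floor are added.
-/

noncomputable section

-- every declaration of this problem lives in `Summit.HodgeConjecture.HodgeConjecture.…` (summit = sub-problem)
set_option linter.dupNamespace false

open CategoryTheory
open Literature.AlgebraicGeometry Literature.AlgebraicGeometry.Motives
open Literature.AlgebraicGeometry.HodgeTheory
open Literature.AlgebraicTopology.SingularHomology
open Literature.AlgebraicGeometry.VanGeemenVerra2003

namespace Summit.HodgeConjecture.HodgeConjecture.WeilTypeLadder

section QuaternionSixfolds

variable {A : Motives.AbelianVariety ℂ} {φ χ : A ⟶ A} {a b : ℕ}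

/-- **Quaternion-type sixfolds: the floor for ONE split quadratic subfield gives the Weil classes of EVERY quadratic
subfield.** `dim A = 6`, `φ² = -a`, `χ² = -b` (`a, b ≥ 1`), `φχ = -χφ`; `h = e^*l` a rational hyperplane class with
`φ^*h = a·h`, `χ^*h = b·h`; `(A, ℚ(φ))` hyperbolic for `a·h + φ^*h` (the floor's binder). Then for every
`(p, q, r) ≠ 0`, `m = p²a + q²b + r²ab`, every class of `weilClassesOf A (pφ + qχ + rφχ) 3 m` is algebraic.
PROOF: F0a gives the rational `(3,3)` classes of `W_{ℚ(φ)}` (`IsWeilType` by Lemma 4.5, so the whole plane,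
`quaternionClasses_le_algebraicClasses_of_isWeilType`); Prop. 4.7 for the anticommuting pair `(φ, φχ)` gives
`W_{ℚ(φχ)} ⊂ W_F = Σ_z z^*W_{ℚ(φ)}`; for `(p, q) ≠ 0` the pair `(φχ, Y)`, `Y = qb·φ - pa·χ`, gives `W_{ℚ(Y)}` and the
pair `(Y, x)` gives `W_{ℚ(x)}`; for `x = r·φχ` the pair `(φ, x)` suffices. The conditions `z^*h = (z z̄)·h` of Prop. 4.7
follow from `φ^*h = a h`, `χ^*h = b h` by `map_pure_two_of_quaternionSymmetric`. Conditional on [Markman 2025, Thm. 1.5.1]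
(F0a, unrefereed) and [van Geemen–Verra 2003, Prop. 4.7] (refereed).
[cite: vanGeemenVerra2003QuaternionicPryms, Lemma 4.5, Prop. 4.7 and Cor. 4.9] [cite: Markman2025SecantWeil, Thm 1.5.1] -/
theorem weilClassesOf_quaternionSixfold_le_algebraicClasses_of_floor
    (hF : Markman2025_weilClasses_algebraic_hyperbolicSixfold) (hV : VanGeemenVerra2003_quaternionHodgeClasses)
    (ha : 0 < a) (hb : 0 < b) (hA : A.dim = 6)
    (hφ : φ ≫ φ = -(a • 𝟙 A)) (hχ : χ ≫ χ = -(b • 𝟙 A)) (hφχ : φ ≫ χ = -(χ ≫ φ))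
    (e : ProjectiveEmbedding A.X) {l : complexBetti (projectiveSpace e.n ℂ) 2} (hl : IsRationalClass l) (hl0 : l ≠ 0)
    (hEφ : complexBetti.map φ.hom.hom.hom 2 (complexBetti.map e.ι 2 l) = (a : ℂ) • complexBetti.map e.ι 2 l)
    (hEχ : complexBetti.map χ.hom.hom.hom 2 (complexBetti.map e.ι 2 l) = (b : ℂ) • complexBetti.map e.ι 2 l)
    (hsplit : IsHyperbolicWeilType A φ 3
      ((a : ℂ) • complexBetti.map e.ι 2 l + complexBetti.map φ.hom.hom.hom 2 (complexBetti.map e.ι 2 l)))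
    (p q r : ℤ) (hpqr : p ≠ 0 ∨ q ≠ 0 ∨ r ≠ 0) (m : ℕ) (hm : (m : ℤ) = p ^ 2 * a + q ^ 2 * b + r ^ 2 * (a * b)) :
    weilClassesOf A (p • φ + q • χ + r • (φ ≫ χ)) 3 m ≤ algebraicClasses A.X 3 := by
  have hA' : A.dim = 2 * 3 := by rw [hA]
  -- the floor on the split structure `(A, ℚ(φ))`: rational `(3,3)` Weil classes, hence the whole plane
  have hWφ : ∀ c ∈ weilClassesOf A φ 3 a, IsRationalClass c → IsOfHodgeType (2 * 3) A.X (2 * 3) 3 3 c →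
      c ∈ algebraicClasses A.X 3 :=
    fun c hc hrat h33 ↦ hF a ha A φ hA' (isSmoothProjective_of_dim_eq' hA') hφ e l hl hl0 hsplit c hrat h33 hc
  have hWeil : IsWeilType A φ 3 a := isWeilType_of_anticomm (by norm_num) ha hb hA' hφ hχ hφχ
  -- the third generator `ψ = φχ`
  have hψ : (φ ≫ χ) ≫ (φ ≫ χ) = -((a * b) • 𝟙 A) := comp_comp_self_of_anticomm hφ hχ hφχ
  have hφψ : φ ≫ (φ ≫ χ) = -((φ ≫ χ) ≫ φ) := anticomm_comp_of_anticomm hφχ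
  have hχψ : χ ≫ (φ ≫ χ) = -((φ ≫ χ) ≫ χ) := by
    rw [← Category.assoc, comp_eq_neg_comp_of_anticomm hφχ, Preadditive.neg_comp, Category.assoc]
  have hab : 0 < a * b := Nat.mul_pos ha hb
  have hEψ : complexBetti.map (φ ≫ χ).hom.hom.hom 2 (complexBetti.map e.ι 2 l) =
      ((a * b : ℕ) : ℂ) • complexBetti.map e.ι 2 l := by
    rw [← complexBetti_map_map_hom, hEχ, map_smul, hEφ, smul_smul, Nat.cast_mul, mul_comm]
  have hm0 : 0 < m := by
    have ha' : (0 : ℤ) < a := by exact_mod_cast ha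
    have hb' : (0 : ℤ) < b := by exact_mod_cast hb
    have : (0 : ℤ) < m := by
      rw [hm]
      rcases hpqr with h0 | h0 | h0 <;> positivity
    exact_mod_cast this
  -- `x² = -m`, `x^*h = m·h`
  have hx2 : (p • φ + q • χ + r • (φ ≫ χ)) ≫ (p • φ + q • χ + r • (φ ≫ χ)) = -(m • 𝟙 A) :=
    pure_comp_pure_eq hφ hχ hφχ p q r hm
  have hEx : complexBetti.map (p • φ + q • χ + r • (φ ≫ χ)).hom.hom.hom 2 (complexBetti.map e.ι 2 l) =
      (m : ℂ) • complexBetti.map e.ι 2 l := by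
    rw [map_pure_two_of_quaternionSymmetric ha hb hφ hχ hφχ hEφ hEχ p q r, ← Int.cast_natCast (R := ℂ) m, hm]
  by_cases hpq : p = 0 ∧ q = 0
  · -- `x = r·φχ`: the pair `(φ, x)`
    obtain ⟨rfl, rfl⟩ := hpq
    have hφx : φ ≫ ((0 : ℤ) • φ + (0 : ℤ) • χ + r • (φ ≫ χ)) = -(((0 : ℤ) • φ + (0 : ℤ) • χ + r • (φ ≫ χ)) ≫ φ) := by
      simp only [zero_smul, zero_add, Preadditive.comp_zsmul, Preadditive.zsmul_comp, hφψ, smul_neg]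
    obtain ⟨-, -, hEq, -⟩ := hV A φ _ 3 a m e l (by norm_num) ha hm0 hA' hφ hx2 hφx hl hl0 hEφ hEx
    calc weilClassesOf A ((0 : ℤ) • φ + (0 : ℤ) • χ + r • (φ ≫ χ)) 3 m
        ≤ quaternionClasses A φ ((0 : ℤ) • φ + (0 : ℤ) • χ + r • (φ ≫ χ))
            ((0 : ℤ) • φ + (0 : ℤ) • χ + r • (φ ≫ χ)) 3 m := weilClassesOf_le_quaternionClasses _ 3 m
      _ = quaternionClasses A φ ((0 : ℤ) • φ + (0 : ℤ) • χ + r • (φ ≫ χ)) φ 3 a := hEq.symm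
      _ ≤ algebraicClasses A.X 3 := quaternionClasses_le_algebraicClasses_of_isWeilType hWeil hWφ
  · -- `(p, q) ≠ (0, 0)`: the chain `φ → φχ → Y → x`, `Y = qb·φ - pa·χ`
    have hpq' : p ≠ 0 ∨ q ≠ 0 := not_and_or.mp hpq
    -- Prop. 4.7 for `(φ, φχ)`: `W_{ℚ(φχ)}` algebraic
    obtain ⟨-, -, hEq1, -⟩ := hV A φ (φ ≫ χ) 3 a (a * b) e l (by norm_num) ha hab hA' hφ hψ hφψ hl hl0 hEφ hEψ
    have hWψ : weilClassesOf A (φ ≫ χ) 3 (a * b) ≤ algebraicClasses A.X 3 :=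
      calc weilClassesOf A (φ ≫ χ) 3 (a * b)
          ≤ quaternionClasses A φ (φ ≫ χ) (φ ≫ χ) 3 (a * b) := weilClassesOf_le_quaternionClasses _ 3 (a * b)
        _ = quaternionClasses A φ (φ ≫ χ) φ 3 a := hEq1.symm
        _ ≤ algebraicClasses A.X 3 := quaternionClasses_le_algebraicClasses_of_isWeilType hWeil hWφ
    -- the partner `Y = (q b)·φ + (-(p a))·χ + 0·φχ`: `Y² = -m'`
    have ha' : (0 : ℤ) < a := by exact_mod_cast ha
    have hb' : (0 : ℤ) < b := by exact_mod_cast hb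
    have hnonneg : (0 : ℤ) ≤ (q * b) ^ 2 * a + (p * a) ^ 2 * b := by positivity
    obtain ⟨m', hm'ℤ⟩ := Int.eq_ofNat_of_zero_le hnonneg
    have hm' : (m' : ℤ) = (q * b) ^ 2 * a + (-(p * a)) ^ 2 * b + 0 ^ 2 * (a * b) := by rw [← hm'ℤ]; ring
    have hm'0 : 0 < m' := by
      have : (0 : ℤ) < m' := by
        rw [← hm'ℤ]
        rcases hpq' with h0 | h0 <;> positivity
      exact_mod_cast this
    have hY2 := pure_comp_pure_eq hφ hχ hφχ (q * b) (-(p * a)) 0 hm'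
    have hxY := pure_anticomm hφ hχ hφχ p q r
    have hYx := comp_eq_neg_comp_of_anticomm hxY
    have hψY : (φ ≫ χ) ≫ ((q * b : ℤ) • φ + (-(p * a) : ℤ) • χ + (0 : ℤ) • (φ ≫ χ)) =
        -(((q * b : ℤ) • φ + (-(p * a) : ℤ) • χ + (0 : ℤ) • (φ ≫ χ)) ≫ (φ ≫ χ)) := by
      simp only [zero_smul, add_zero, Preadditive.comp_add, Preadditive.add_comp, Preadditive.comp_zsmul,
        Preadditive.zsmul_comp, comp_eq_neg_comp_of_anticomm hφψ, comp_eq_neg_comp_of_anticomm hχψ,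
        smul_neg, neg_add]
    have hEY : complexBetti.map ((q * b : ℤ) • φ + (-(p * a) : ℤ) • χ + (0 : ℤ) • (φ ≫ χ)).hom.hom.hom 2
        (complexBetti.map e.ι 2 l) = (m' : ℂ) • complexBetti.map e.ι 2 l := by
      rw [map_pure_two_of_quaternionSymmetric ha hb hφ hχ hφχ hEφ hEχ, ← Int.cast_natCast (R := ℂ) m', hm']
    -- Prop. 4.7 for `(φχ, Y)`: `W_{ℚ(Y)}` algebraic
    obtain ⟨-, -, hEq2, -⟩ := hV A (φ ≫ χ) _ 3 (a * b) m' e l (by norm_num) hab hm'0 hA' hψ hY2 hψY hl hl0 hEψ hEY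
    have hWY : weilClassesOf A ((q * b : ℤ) • φ + (-(p * a) : ℤ) • χ + (0 : ℤ) • (φ ≫ χ)) 3 m' ≤
        algebraicClasses A.X 3 :=
      calc weilClassesOf A _ 3 m'
          ≤ quaternionClasses A (φ ≫ χ) _ _ 3 m' := weilClassesOf_le_quaternionClasses _ 3 m'
        _ = quaternionClasses A (φ ≫ χ) _ (φ ≫ χ) 3 (a * b) := hEq2.symm
        _ ≤ algebraicClasses A.X 3 := quaternionClasses_le_algebraicClasses (φ ≫ χ) 3 (a * b) hWψ
    -- Prop. 4.7 for `(Y, x)`: `W_{ℚ(x)}` algebraic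
    obtain ⟨-, -, hEq3, -⟩ := hV A _ _ 3 m' m e l (by norm_num) hm'0 hm0 hA' hY2 hx2 hYx hl hl0 hEY hEx
    calc weilClassesOf A (p • φ + q • χ + r • (φ ≫ χ)) 3 m
        ≤ quaternionClasses A _ (p • φ + q • χ + r • (φ ≫ χ)) (p • φ + q • χ + r • (φ ≫ χ)) 3 m :=
          weilClassesOf_le_quaternionClasses _ 3 m
      _ = quaternionClasses A _ (p • φ + q • χ + r • (φ ≫ χ)) _ 3 m' := hEq3.symm
      _ ≤ algebraicClasses A.X 3 := quaternionClasses_le_algebraicClasses _ 3 m' hWY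

/-- **R1′ (`NonsplitSixfolds`) on the quaternion-type locus FOLLOWS FROM THE FLOOR F0a** (and the van Geemen–Verra
fact): the literal body of the rung at `(A, φ, d) := (A, x, m)`, `x = pφ + qχ + rφχ`, for a sixfold of quaternion type
carrying ONE split structure `(A, ℚ(φ))` — the rung's binder "no `(e', a')` makes `(A, x)` hyperbolic" is carried and
not used (when it holds, `(A, ℚ(x))` is a genuinely NON-split Weil sixfold whose Weil classes the floor reaches through
`ℚ(φ)`). Conditional on [Markman 2025, Thm. 1.5.1] (unrefereed) + [van Geemen–Verra 2003, Prop. 4.7].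
[cite: vanGeemenVerra2003QuaternionicPryms, Prop. 4.7 and Cor. 4.9] [cite: Markman2025SecantWeil, Thm 1.5.1] -/
theorem nonsplitSixfolds_quaternionType_of_floor
    (hF : Markman2025_weilClasses_algebraic_hyperbolicSixfold) (hV : VanGeemenVerra2003_quaternionHodgeClasses)
    (ha : 0 < a) (hb : 0 < b) (hA : A.dim = 6)
    (hφ : φ ≫ φ = -(a • 𝟙 A)) (hχ : χ ≫ χ = -(b • 𝟙 A)) (hφχ : φ ≫ χ = -(χ ≫ φ))
    (e : ProjectiveEmbedding A.X) {l : complexBetti (projectiveSpace e.n ℂ) 2} (hl : IsRationalClass l) (hl0 : l ≠ 0)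
    (hEφ : complexBetti.map φ.hom.hom.hom 2 (complexBetti.map e.ι 2 l) = (a : ℂ) • complexBetti.map e.ι 2 l)
    (hEχ : complexBetti.map χ.hom.hom.hom 2 (complexBetti.map e.ι 2 l) = (b : ℂ) • complexBetti.map e.ι 2 l)
    (hsplit : IsHyperbolicWeilType A φ 3
      ((a : ℂ) • complexBetti.map e.ι 2 l + complexBetti.map φ.hom.hom.hom 2 (complexBetti.map e.ι 2 l)))
    (p q r : ℤ) (hpqr : p ≠ 0 ∨ q ≠ 0 ∨ r ≠ 0) (m : ℕ) (hm : (m : ℤ) = p ^ 2 * a + q ^ 2 * b + r ^ 2 * (a * b)) :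
    0 < m → A.dim = 2 * 3 → IsSmoothProjective (2 * 3) A.X →
      (p • φ + q • χ + r • (φ ≫ χ)) ≫ (p • φ + q • χ + r • (φ ≫ χ)) = -(m • 𝟙 A) →
      (∀ (e' : ProjectiveEmbedding A.X) (a' : complexBetti (projectiveSpace e'.n ℂ) 2),
        IsRationalClass a' → a' ≠ 0 →
          ¬ IsHyperbolicWeilType A (p • φ + q • χ + r • (φ ≫ χ)) 3
            ((m : ℂ) • complexBetti.map e'.ι 2 a' +
              complexBetti.map (p • φ + q • χ + r • (φ ≫ χ)).hom.hom.hom 2 (complexBetti.map e'.ι 2 a'))) →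
      ∀ c : complexBetti A.X (2 * 3), IsRationalClass c → IsOfHodgeType (2 * 3) A.X (2 * 3) 3 3 c →
        c ∈ weilClassesOf A (p • φ + q • χ + r • (φ ≫ χ)) 3 m → c ∈ algebraicClasses A.X 3 :=
  fun _ _ _ _ _ _ _ _ hc ↦
    weilClassesOf_quaternionSixfold_le_algebraicClasses_of_floor hF hV ha hb hA hφ hχ hφχ e hl hl0 hEφ hEχ hsplit
      p q r hpqr m hm hc

/-- **On-path lemma**: the Hodge conjecture implies the same R1′ body on the quaternion-type locus
(`HodgeConjecture → NonsplitSixfolds →` the locus; no fact and no split structure needed). -/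
theorem nonsplitSixfolds_quaternionType_of_hodgeConjecture (h : _root_.HodgeConjecture)
    (p q r : ℤ) (m : ℕ) :
    0 < m → A.dim = 2 * 3 → IsSmoothProjective (2 * 3) A.X →
      (p • φ + q • χ + r • (φ ≫ χ)) ≫ (p • φ + q • χ + r • (φ ≫ χ)) = -(m • 𝟙 A) →
      (∀ (e' : ProjectiveEmbedding A.X) (a' : complexBetti (projectiveSpace e'.n ℂ) 2),
        IsRationalClass a' → a' ≠ 0 →
          ¬ IsHyperbolicWeilType A (p • φ + q • χ + r • (φ ≫ χ)) 3
            ((m : ℂ) • complexBetti.map e'.ι 2 a' +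
              complexBetti.map (p • φ + q • χ + r • (φ ≫ χ)).hom.hom.hom 2 (complexBetti.map e'.ι 2 a'))) →
      ∀ c : complexBetti A.X (2 * 3), IsRationalClass c → IsOfHodgeType (2 * 3) A.X (2 * 3) 3 3 c →
        c ∈ weilClassesOf A (p • φ + q • χ + r • (φ ≫ χ)) 3 m → c ∈ algebraicClasses A.X 3 :=
  fun hm hA hX hx hnon c hc h33 hW ↦ nonsplitSixfolds_of_hodgeConjecture h m hm A _ hA hX hx hnon c hc h33 hW

end QuaternionSixfolds

end Summit.HodgeConjecture.HodgeConjecture.WeilTypeLadder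

end
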